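import Summits.ResolutionOfSingularities.ResolutionOfSingularities.Theorems.EquisingularLiftEquisingularLiftNatVertexExitChartC
import HarnessLib

/-!
# [OURS · L1 W4.5(b) · EL♮] K-VERTEX-EXIT (chart `y₂`, and both charts): the Σ-touch regularises the K5-VERTEX —
# chart `y₂ ≠ 0` of `Bl_{(c̄,ȳ₂)} 𝒞` is an affine `4`-space; every chart is regular
# (crux `EquisingularLiftNat` = stmt-ResolutionOfSingularities-20038; K-∀n / K5-BMY lane, kill test #50)

HONEST FRAMING. OURS (cell res-hironaka, crux chain w45b, slot W4.5(b)); NOT a statement of any manuscript; replaces the role of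
NOTHING in the manuscript; AI-written, AI review is weaker than expert review. Helper `--supports stmt-ResolutionOfSingularities-20038
--as helper`. Sequel of `…NatVertexExitChartC` (the model `𝒪_𝒞 = k[x₃,c,y₁,x₁,y₂,d]/I₂(N)`, the trace `trc = (c̄, ȳ₂)`, chart `c`); object
K-VERTEX-EXIT of res-L1-w45b-strat-1's STRATEGY-CENSUS v11 (sha16 6d78683fc4832623) §4 (N6.1 (b)(d)) / §5 R2‴, model form.

THE THEOREM (N6.1 (b) «chart `c = −y₂·s`: `St(𝒞) = V(x₃ − x₁s, y₁ − sd)` — REGULAR»; here with the sign `s = c̄/ȳ₂`):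
`ψ_y : k[x₁, y₂, d, s] → B_y := 𝒪_𝒞[(c̄, ȳ₂)/ȳ₂]`, `s ↦ c̄/ȳ₂`, is a BIJECTION for `k` a domain (`ψy_bijective`), with graph relations
`x̄₃ = −x̄₁·s`, `ȳ₁ = −d̄·s` (`algebraMap_x₃_eqy`, `algebraMap_y₁_eqy`); for a field `B_y` is regular (`isRegularRing_By`) and so is EVERY
chart of the blow-up of the vertex `𝒞` along the Σ-centre's trace (`isRegularRing_chart`): the VERDICT «VTX-LOCAL decided, positive» of
STRATEGY-CENSUS v11 at model level (`A = B = 0` in N6.1 (d)). Proof as for chart `c`: onto by the relations, injective by the left inverse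
`Λ_y : 𝒪_𝒞[1/ȳ₂] → k[x₁,y₂,d,s][1/y₂]`, `x₃ ↦ −x₁s`, `c ↦ y₂s`, `y₁ ↦ −ds`. Model coordinates `X 0,…,X 3 = x₁, y₂, d, s`.

References: res-L1-w45b-strat-1 STRATEGY-CENSUS v11 N6.1; [StacksProject, Tags 052P/052Q/080E]; [GortzWedhorn2020, (13.19) p. 415].
-/

set_option linter.dupNamespace false -- mandated namespace `Summit.<Summit>.<Problem>` of this single-conjunct summit

noncomputable section

universe u

open Literature.AlgebraicGeometry.Resolution MvPolynomial

namespace Summit.ResolutionOfSingularities.ResolutionOfSingularities.Cruxes.EquisingularLiftNat.Sections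

namespace VertexExit

variable (k : Type u) [CommRing k]

/-! # Chart `y₂` (`s = c̄/ȳ₂`): `B_y = 𝒪_𝒞[(c̄,ȳ₂)/ȳ₂] ≅ k[x₁, y₂, d, s]` with `x̄₃ = −x̄₁s`, `ȳ₁ = −d̄s` -/

/-- The chart `B_y = 𝒪_𝒞[(c̄, ȳ₂)/ȳ₂] ⊆ 𝒪_𝒞[1/ȳ₂]`. OURS bookkeeping. -/
abbrev By : Subalgebra (OC k) (Localization.Away (trc k 1)) := blowupAlgebra (Ideal.span (Set.range (trc k))) (trc k 1)

/-- The values of the model coordinates `x₁, y₂, d, s` in `B_y`: `x̄₁`, `ȳ₂`, `d̄`, `c̄/ȳ₂`. OURS bookkeeping. -/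
def cvy : Fin 4 → By k :=
  ![algebraMap (OC k) (By k) (mkC k (X 3)), algebraMap (OC k) (By k) (mkC k (X 4)), algebraMap (OC k) (By k) (mkC k (X 5)),
    blowupAlgebra.frac (trc k) 1 0]

/-- **`ψ_y : k[x₁, y₂, d, s] → B_y`**, `s ↦ c̄/ȳ₂` (model coordinates `X 0,…,X 3 = x₁, y₂, d, s`). OURS bookkeeping. -/
def ψy : MvPolynomial (Fin 4) k →+* By k :=
  MvPolynomial.eval₂Hom ((algebraMap (OC k) (By k)).comp ((mkC k).comp MvPolynomial.C)) (cvy k)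

/-- `m₁₂ = 0` in `𝒪_𝒞`: `x̄₃ ȳ₂ = −x̄₁ c̄`. [folklore] -/
theorem x₃_mul_y₂ : mkC k (X 0) * mkC k (X 4) = -(mkC k (X 3) * mkC k (X 1)) := by
  rw [← map_mul, ← map_mul, ← map_neg, Ideal.Quotient.eq]
  refine Ideal.subset_span (Or.inl ?_)
  rw [m₁₂]; ring

/-- `m₂₃ = 0` in `𝒪_𝒞`: `ȳ₁ ȳ₂ = −d̄ c̄`. [folklore] -/
theorem y₁_mul_y₂ : mkC k (X 2) * mkC k (X 4) = -(mkC k (X 5) * mkC k (X 1)) := by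
  rw [← map_mul, ← map_mul, ← map_neg, Ideal.Quotient.eq]
  have h : (X 2 * X 4 - -(X 5 * X 1) : MvPolynomial (Fin 6) k) = -m₂₃ k := by rw [m₂₃]; ring
  rw [h]
  exact (minors k).neg_mem (Ideal.subset_span (by simp))

/-- `ȳ₂ · (1/ȳ₂) = 1` in `𝒪_𝒞[1/ȳ₂]`. [folklore] -/
theorem y₂_mul_invSelf :
    algebraMap (OC k) (Localization.Away (trc k 1)) (trc k 1) * IsLocalization.Away.invSelf (trc k 1) = 1 :=
  IsLocalization.Away.mul_invSelf (S := Localization.Away (trc k 1)) (trc k 1)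

/-- `ψ_y` on constants. [folklore] -/
theorem ψy_C (a : k) : ψy k (C a) = algebraMap (OC k) (By k) (mkC k (C a)) := MvPolynomial.eval₂Hom_C _ _ a

/-- `ψ_y x₁ = x̄₁`. [folklore] -/
theorem ψy_X₀ : ψy k (X 0) = algebraMap (OC k) (By k) (mkC k (X 3)) := MvPolynomial.eval₂Hom_X' _ _ 0

/-- `ψ_y y₂ = ȳ₂`. [folklore] -/
theorem ψy_X₁ : ψy k (X 1) = algebraMap (OC k) (By k) (mkC k (X 4)) := MvPolynomial.eval₂Hom_X' _ _ 1

/-- `ψ_y d = d̄`. [folklore] -/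
theorem ψy_X₂ : ψy k (X 2) = algebraMap (OC k) (By k) (mkC k (X 5)) := MvPolynomial.eval₂Hom_X' _ _ 2

/-- `ψ_y s = c̄/ȳ₂`. [folklore] -/
theorem ψy_X₃ : ψy k (X 3) = blowupAlgebra.frac (trc k) 1 0 := MvPolynomial.eval₂Hom_X' _ _ 3

/-- **N6.1 (b), chart `y₂`, first graph relation: `x̄₃ = −x̄₁·s` in `B_y`.** [folklore] -/
theorem algebraMap_x₃_eqy : algebraMap (OC k) (By k) (mkC k (X 0)) = -(ψy k (X 0) * ψy k (X 3)) := by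
  rw [ψy_X₀, ψy_X₃]
  apply Subtype.ext
  rw [Subalgebra.coe_neg, Subalgebra.coe_mul, blowupAlgebra.coe_frac]
  refine rel_div _ _ _ _ _ (y₂_mul_invSelf k) ?_
  change algebraMap (OC k) (Localization.Away (trc k 1)) (mkC k (X 0)) * algebraMap (OC k) _ (mkC k (X 4)) =
    -(algebraMap (OC k) _ (mkC k (X 3)) * algebraMap (OC k) _ (mkC k (X 1)))
  rw [← map_mul (algebraMap (OC k) (Localization.Away (trc k 1))), ← map_mul (algebraMap (OC k) (Localization.Away (trc k 1))),
    ← map_neg (algebraMap (OC k) (Localization.Away (trc k 1))), x₃_mul_y₂]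

/-- **N6.1 (b), chart `y₂`, second graph relation: `ȳ₁ = −d̄·s` in `B_y`.** [folklore] -/
theorem algebraMap_y₁_eqy : algebraMap (OC k) (By k) (mkC k (X 2)) = -(ψy k (X 2) * ψy k (X 3)) := by
  rw [ψy_X₂, ψy_X₃]
  apply Subtype.ext
  rw [Subalgebra.coe_neg, Subalgebra.coe_mul, blowupAlgebra.coe_frac]
  refine rel_div _ _ _ _ _ (y₂_mul_invSelf k) ?_
  change algebraMap (OC k) (Localization.Away (trc k 1)) (mkC k (X 2)) * algebraMap (OC k) _ (mkC k (X 4)) =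
    -(algebraMap (OC k) _ (mkC k (X 5)) * algebraMap (OC k) _ (mkC k (X 1)))
  rw [← map_mul (algebraMap (OC k) (Localization.Away (trc k 1))), ← map_mul (algebraMap (OC k) (Localization.Away (trc k 1))),
    ← map_neg (algebraMap (OC k) (Localization.Away (trc k 1))), y₁_mul_y₂]

/-- `c̄ = ȳ₂ · s` in `B_y`. [folklore] -/
theorem algebraMap_c_eqy : algebraMap (OC k) (By k) (mkC k (X 1)) = ψy k (X 1) * ψy k (X 3) := by
  rw [ψy_X₁, ψy_X₃]
  apply Subtype.ext
  rw [Subalgebra.coe_mul, blowupAlgebra.coe_frac]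
  exact rel_mul _ _ _ (y₂_mul_invSelf k)

/-- Every `x̄ⱼ` lies in the image of `ψ_y`. [folklore] -/
theorem algebraMap_X_mem_rangey (j : Fin 6) : algebraMap (OC k) (By k) (mkC k (X j)) ∈ (ψy k).range := by
  match j with
  | ⟨0, _⟩ =>
    exact (show algebraMap (OC k) (By k) (mkC k (X 0)) ∈ (ψy k).range from
      ⟨-(X 0 * X 3), by rw [map_neg, map_mul, ← algebraMap_x₃_eqy]⟩)
  | ⟨1, _⟩ =>
    exact (show algebraMap (OC k) (By k) (mkC k (X 1)) ∈ (ψy k).range from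
      ⟨X 1 * X 3, by rw [map_mul, ← algebraMap_c_eqy]⟩)
  | ⟨2, _⟩ =>
    exact (show algebraMap (OC k) (By k) (mkC k (X 2)) ∈ (ψy k).range from
      ⟨-(X 2 * X 3), by rw [map_neg, map_mul, ← algebraMap_y₁_eqy]⟩)
  | ⟨3, _⟩ => exact ⟨X 0, ψy_X₀ k⟩
  | ⟨4, _⟩ => exact ⟨X 1, ψy_X₁ k⟩
  | ⟨5, _⟩ => exact ⟨X 2, ψy_X₂ k⟩

/-- Every constant lies in the image of `ψ_y`. [folklore] -/
theorem algebraMap_mem_rangey (y : OC k) : algebraMap (OC k) (By k) y ∈ (ψy k).range := by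
  obtain ⟨G, rfl⟩ := Ideal.Quotient.mk_surjective y
  induction G using MvPolynomial.induction_on with
  | C a => exact ⟨C a, ψy_C k a⟩
  | add p q hp hq => rw [map_add, map_add]; exact add_mem hp hq
  | mul_X p j hp => rw [map_mul, map_mul]; exact mul_mem hp (algebraMap_X_mem_rangey k j)

/-- Every fraction lies in the image of `ψ_y`. [folklore] -/
theorem frac_mem_rangey (j : Fin 2) : blowupAlgebra.frac (trc k) 1 j ∈ (ψy k).range := by
  have h1 : blowupAlgebra.frac (trc k) 1 1 ∈ (ψy k).range := by
    refine ⟨1, ?_⟩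
    rw [map_one]
    apply Subtype.ext
    rw [blowupAlgebra.coe_frac, OneMemClass.coe_one]
    exact (y₂_mul_invSelf k).symm
  match j with
  | ⟨0, _⟩ => exact ⟨X 3, ψy_X₃ k⟩
  | ⟨1, _⟩ => exact h1

/-- **`ψ_y` is onto.** [folklore] -/
theorem ψy_surjective : Function.Surjective (ψy k) := by
  intro z
  obtain ⟨F, rfl⟩ := blowupAlgebra.eval_surjective (trc k) 1 z
  suffices h : (blowupAlgebra.eval (trc k) 1 F) ∈ (ψy k).range by exact h
  induction F using MvPolynomial.induction_on with
  | C y => rw [blowupAlgebra.eval_C]; exact algebraMap_mem_rangey k y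
  | add p q hp hq => rw [map_add]; exact add_mem hp hq
  | mul_X p j hp => rw [map_mul, blowupAlgebra.eval_X]; exact mul_mem hp (frac_mem_rangey k j.1)

/-- The inverse substitution `x₃ ↦ −x₁s, c ↦ y₂s, y₁ ↦ −ds, x₁ ↦ x₁, y₂ ↦ y₂, d ↦ d`. OURS bookkeeping. -/
def lamValy : Fin 6 → MvPolynomial (Fin 4) k := ![-(X 0 * X 3), X 1 * X 3, -(X 2 * X 3), X 0, X 1, X 2]

/-- `x₃ ↦ −x₁s`. [folklore] -/
theorem lamValy_0 : lamValy k 0 = -(X 0 * X 3) := rfl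
/-- `c ↦ y₂s`. [folklore] -/
theorem lamValy_1 : lamValy k 1 = X 1 * X 3 := rfl
/-- `y₁ ↦ −ds`. [folklore] -/
theorem lamValy_2 : lamValy k 2 = -(X 2 * X 3) := rfl
/-- `x₁ ↦ x₁`. [folklore] -/
theorem lamValy_3 : lamValy k 3 = X 0 := rfl
/-- `y₂ ↦ y₂`. [folklore] -/
theorem lamValy_4 : lamValy k 4 = X 1 := rfl
/-- `d ↦ d`. [folklore] -/
theorem lamValy_5 : lamValy k 5 = X 2 := rfl

/-- The substitution kills the three minors. [folklore] -/
theorem minors_le_kery : minors k ≤ RingHom.ker (MvPolynomial.eval₂Hom MvPolynomial.C (lamValy k)) := by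
  rw [minors, Ideal.span_le]
  rintro F (rfl | rfl | rfl)
  · rw [SetLike.mem_coe, RingHom.mem_ker, m₁₂]
    simp only [map_add, map_mul, MvPolynomial.eval₂Hom_X', lamValy_0, lamValy_1, lamValy_3, lamValy_4]
    ring
  · rw [SetLike.mem_coe, RingHom.mem_ker, m₁₃]
    simp only [map_sub, map_mul, MvPolynomial.eval₂Hom_X', lamValy_0, lamValy_2, lamValy_3, lamValy_5]
    ring
  · rw [SetLike.mem_coe, RingHom.mem_ker, m₂₃]
    simp only [map_sub, map_neg, map_mul, MvPolynomial.eval₂Hom_X', lamValy_1, lamValy_2, lamValy_4, lamValy_5]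
    ring

/-- `λ_y : 𝒪_𝒞 → k[x₁,y₂,d,s][1/y₂]`. OURS bookkeeping. -/
def lamy : OC k →+* Localization.Away (X 1 : MvPolynomial (Fin 4) k) :=
  Ideal.Quotient.lift (minors k)
    ((algebraMap (MvPolynomial (Fin 4) k) (Localization.Away (X 1 : MvPolynomial (Fin 4) k))).comp
      (MvPolynomial.eval₂Hom MvPolynomial.C (lamValy k)))
    (fun a ha => by rw [RingHom.comp_apply, RingHom.mem_ker.mp (minors_le_kery k ha), map_zero])

/-- `λ_y` on classes. [folklore] -/
theorem lamy_mkC (F : MvPolynomial (Fin 6) k) :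
    lamy k (mkC k F) = algebraMap (MvPolynomial (Fin 4) k) (Localization.Away (X 1 : MvPolynomial (Fin 4) k))
      (MvPolynomial.eval₂Hom MvPolynomial.C (lamValy k) F) :=
  Ideal.Quotient.lift_mk _ _ _

/-- `λ_y(ȳ₂) = y₂`. [folklore] -/
theorem lamy_trc_one : lamy k (trc k 1) =
    algebraMap (MvPolynomial (Fin 4) k) (Localization.Away (X 1 : MvPolynomial (Fin 4) k)) (X 1) := by
  change lamy k (mkC k (X 4)) = _
  rw [lamy_mkC, MvPolynomial.eval₂Hom_X', lamValy_4]

/-- `λ_y(ȳ₂)` is a unit. [folklore] -/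
theorem isUnit_lamy_trc_one : IsUnit (lamy k (trc k 1)) := by
  rw [lamy_trc_one]
  exact IsLocalization.Away.algebraMap_isUnit (X 1 : MvPolynomial (Fin 4) k)

/-- **`Λ_y : 𝒪_𝒞[1/ȳ₂] → k[x₁,y₂,d,s][1/y₂]`**, the left inverse of `ψ_y` after localisation. OURS bookkeeping. -/
def Λy : Localization.Away (trc k 1) →+* Localization.Away (X 1 : MvPolynomial (Fin 4) k) :=
  IsLocalization.Away.lift (trc k 1) (isUnit_lamy_trc_one k)

/-- `Λ_y` extends `λ_y`. [folklore] -/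
theorem Λy_algebraMap (y : OC k) : Λy k (algebraMap (OC k) (Localization.Away (trc k 1)) y) = lamy k y :=
  IsLocalization.Away.lift_eq (trc k 1) (isUnit_lamy_trc_one k) y

/-- `Λ_y` on a fraction `r/ȳ₂`: if `λ_y r = t · λ_y ȳ₂` then `Λ_y (r/ȳ₂) = t`. [folklore] -/
theorem Λy_frac {r : OC k} {t : Localization.Away (X 1 : MvPolynomial (Fin 4) k)} (h : lamy k r = t * lamy k (trc k 1)) :
    Λy k (algebraMap (OC k) (Localization.Away (trc k 1)) r * IsLocalization.Away.invSelf (trc k 1)) = t := by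
  refine (isUnit_lamy_trc_one k).mul_left_injective ?_
  dsimp only
  rw [← h, ← Λy_algebraMap k (trc k 1), ← map_mul, mul_assoc, mul_comm (IsLocalization.Away.invSelf (trc k 1)),
    y₂_mul_invSelf, mul_one, Λy_algebraMap]

/-- **`Λ_y ∘ ψ_y = (k[x₁,y₂,d,s] → k[x₁,y₂,d,s][1/y₂])`.** [folklore] -/
theorem Λy_comp_ψy :
    (Λy k).comp (((By k).val : By k →+* Localization.Away (trc k 1)).comp (ψy k)) =
      algebraMap (MvPolynomial (Fin 4) k) (Localization.Away (X 1 : MvPolynomial (Fin 4) k)) := by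
  refine MvPolynomial.ringHom_ext (fun a => ?_) (fun j => ?_)
  · rw [RingHom.comp_apply, RingHom.comp_apply, ψy_C]
    change Λy k (algebraMap (OC k) (Localization.Away (trc k 1)) (mkC k (C a))) = _
    rw [Λy_algebraMap, lamy_mkC, MvPolynomial.eval₂Hom_C]
  · rw [RingHom.comp_apply, RingHom.comp_apply]
    match j with
    | ⟨0, _⟩ =>
      change Λy k ((ψy k (X 0) : By k) : Localization.Away (trc k 1)) = algebraMap _ _ (X 0)
      rw [ψy_X₀]
      change Λy k (algebraMap (OC k) (Localization.Away (trc k 1)) (mkC k (X 3))) = _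
      rw [Λy_algebraMap, lamy_mkC, MvPolynomial.eval₂Hom_X']
      rfl
    | ⟨1, _⟩ =>
      change Λy k ((ψy k (X 1) : By k) : Localization.Away (trc k 1)) = algebraMap _ _ (X 1)
      rw [ψy_X₁]
      change Λy k (algebraMap (OC k) (Localization.Away (trc k 1)) (mkC k (X 4))) = _
      rw [Λy_algebraMap, lamy_mkC, MvPolynomial.eval₂Hom_X']
      rfl
    | ⟨2, _⟩ =>
      change Λy k ((ψy k (X 2) : By k) : Localization.Away (trc k 1)) = algebraMap _ _ (X 2)
      rw [ψy_X₂]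
      change Λy k (algebraMap (OC k) (Localization.Away (trc k 1)) (mkC k (X 5))) = _
      rw [Λy_algebraMap, lamy_mkC, MvPolynomial.eval₂Hom_X']
      rfl
    | ⟨3, _⟩ =>
      change Λy k ((ψy k (X 3) : By k) : Localization.Away (trc k 1)) = algebraMap _ _ (X 3)
      rw [ψy_X₃, blowupAlgebra.coe_frac]
      refine Λy_frac k ?_
      change lamy k (mkC k (X 1)) = _
      rw [lamy_trc_one, lamy_mkC, MvPolynomial.eval₂Hom_X', ← map_mul, lamValy_1, mul_comm]

/-- **`ψ_y` is injective** (`k` a domain). [folklore] -/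
theorem ψy_injective [IsDomain k] : Function.Injective (ψy k) := by
  have hinj : Function.Injective
      (algebraMap (MvPolynomial (Fin 4) k) (Localization.Away (X 1 : MvPolynomial (Fin 4) k))) :=
    IsLocalization.injective _ (powers_le_nonZeroDivisors_of_noZeroDivisors (MvPolynomial.X_ne_zero 1))
  rw [← Λy_comp_ψy, RingHom.coe_comp, RingHom.coe_comp] at hinj
  exact hinj.of_comp.of_comp

/-- **K-VERTEX-EXIT, chart `y₂` (N6.1 (b)(d), model form): `ψ_y : k[x₁, y₂, d, s] → B_y` is a bijection** — the graph `x̄₃ = −x̄₁s`,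
`ȳ₁ = −d̄s`. OURS. -/
theorem ψy_bijective [IsDomain k] : Function.Bijective (ψy k) :=
  ⟨ψy_injective k, ψy_surjective k⟩

/-- **The chart `B_y` is a regular ring** (over a field). OURS. -/
theorem isRegularRing_By (K : Type u) [Field K] : IsRegularRing (By K) :=
  IsRegularRing.of_ringEquiv (RingEquiv.ofBijective (ψy K) (ψy_bijective K))

/-- **K-VERTEX-EXIT (N6.1 (b)(d), model form), both charts: the blow-up of the determinantal vertex `𝒞 = {rk N ≤ 1}` along the
Σ-centre's trace `(c̄, ȳ₂)` is REGULAR on every chart** — «ONE E1-legal touch of relative dimension 3 regularises St(𝒞) over v_P»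
(VERDICT VTX-LOCAL of STRATEGY-CENSUS v11, model level). OURS. -/
theorem isRegularRing_chart (K : Type u) [Field K] (i : Fin 2) :
    IsRegularRing (blowupAlgebra (Ideal.span (Set.range (trc K))) (trc K i)) := by
  match i with
  | ⟨0, _⟩ => exact isRegularRing_Bc K
  | ⟨1, _⟩ => exact isRegularRing_By K

end VertexExit

end Summit.ResolutionOfSingularities.ResolutionOfSingularities.Cruxes.EquisingularLiftNat.Sections
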